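import Mathlib.Combinatorics.SetFamily.FourFunctions
import Mathlib.Data.Real.Basic
import Mathlib.Tactic.Linarith
import Mathlib.Tactic.Ring
import Mathlib.Tactic.Positivity
import HarnessLib
import HarnessLib.Audit

/-!
# `NoHeavyLowerTail` (crux stmt-CriticalPhenomena-4575), Sahi programme P4: the 2×2 exchange lemma — conditional Harris on a principal slot

Support file (cell `prim-l12`, seat P4, generation 22; `--supports stmt-CriticalPhenomena-4575`).  No named facts, no sorries;
standard axioms; def-free.

Context (HOME prim-l12-p4/FROM-prim-l12-p4-gen22-SATURATION.md §0 F5; companion of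
`…SahiE3ExchangeDom.exchange_of_dom`).  `exchange_of_dom` proves the 2×2 exchange lemma from the two DOM inequalities under the
hypothesis that the pairs `(K,K')`, `(L,L')`, `(P,P')`, `(O,O')` are nonnegatively correlated CONDITIONALLY ON THE SLOT `V`:
`w(V)·w(X∩Y∩V) ≥ w(X∩V)·w(Y∩V)`.  This file discharges that hypothesis for PRINCIPAL slots: on a finite distributive lattice with
a log-supermodular weight `μ ≥ 0` (the FKG lattice condition `μ(a)μ(b) ≤ μ(a⊓b)μ(a⊔b)`; product measures on a product of chains are
the basic example), if `V = {a : t ≤ a}` is a principal filter then the restricted weight `μ·1_V` is again log-supermodular, so the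
FKG inequality (Mathlib `fkg`, [Fortuin–Kasteleyn–Ginibre 1971]) applied to the indicators of two up-sets `X, Y` gives exactly the
conditional Harris inequality.  With `t = ⊥` it is the plain Harris inequality used for the other hypotheses of `exchange_of_dom`
(`v·w(X) ≤ w(X∩V)` is the case `Y = V`).  Hence the exchange lemma holds for every principal slot, every configuration and every
certificate dominating `a` on the two same-footprints (memo F5).
-/

namespace Summit.CriticalPhenomena.PercolationContinuityZ3.Theorems.SahiE3ExchangeDomPrincipal

open Finset
open scoped BigOperators

variable {α : Type*} [DistribLattice α] [Fintype α] [DecidableEq α]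

/-- **Harris / FKG conditionally on a principal filter.**  For a log-supermodular weight `μ ≥ 0` on a finite distributive lattice,
an element `t`, the principal filter `V = {a | t ≤ a}` (given as a finset with its membership characterisation) and two up-sets
`X, Y` (finsets closed upwards): `μ(X∩V)·μ(Y∩V) ≤ μ(V)·μ(X∩Y∩V)`.  Proof: `μ·1_V` is log-supermodular (if `t ≤ a` and `t ≤ b`
then `t ≤ a ⊓ b` and `t ≤ a ⊔ b`), and Mathlib's `fkg` for the monotone indicators `1_X`, `1_Y`.
[FortuinKasteleynGinibre1971; this corollary: this work] -/
theorem harris_principal_filter (μ : α → ℝ) (hμ₀ : ∀ a, 0 ≤ μ a)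
    (hμ : ∀ a b, μ a * μ b ≤ μ (a ⊓ b) * μ (a ⊔ b)) (t : α) (V X Y : Finset α)
    (hV : ∀ a, a ∈ V ↔ t ≤ a)
    (hX : ∀ a ∈ X, ∀ b, a ≤ b → b ∈ X) (hY : ∀ a ∈ Y, ∀ b, a ≤ b → b ∈ Y) :
    (∑ a ∈ X ∩ V, μ a) * (∑ a ∈ Y ∩ V, μ a) ≤ (∑ a ∈ V, μ a) * (∑ a ∈ (X ∩ Y) ∩ V, μ a) := by
  -- restricted weight and indicator functions
  set μ' : α → ℝ := fun a => if a ∈ V then μ a else 0 with hμ'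
  set f : α → ℝ := fun a => if a ∈ X then 1 else 0 with hf
  set g : α → ℝ := fun a => if a ∈ Y then 1 else 0 with hg
  have hμ'₀ : 0 ≤ μ' := fun a => by
    simp only [hμ', Pi.zero_apply]; split_ifs
    · exact hμ₀ a
    · exact le_rfl
  have hμ'nn : ∀ a, 0 ≤ μ' a := fun a => hμ'₀ a
  have hf₀ : 0 ≤ f := fun a => by
    simp only [hf, Pi.zero_apply]; split_ifs <;> norm_num
  have hg₀ : 0 ≤ g := fun a => by
    simp only [hg, Pi.zero_apply]; split_ifs <;> norm_num
  have hfm : Monotone f := by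
    intro a b hab
    simp only [hf]
    by_cases ha : a ∈ X
    · have hb : b ∈ X := hX a ha b hab
      simp [ha, hb]
    · simp only [ha, if_false]; split_ifs <;> norm_num
  have hgm : Monotone g := by
    intro a b hab
    simp only [hg]
    by_cases ha : a ∈ Y
    · have hb : b ∈ Y := hY a ha b hab
      simp [ha, hb]
    · simp only [ha, if_false]; split_ifs <;> norm_num
  have hμ'l : ∀ a b, μ' a * μ' b ≤ μ' (a ⊓ b) * μ' (a ⊔ b) := by
    intro a b
    by_cases ha : a ∈ V
    · by_cases hb : b ∈ V
      · have h1 : a ⊓ b ∈ V := (hV _).2 (le_inf ((hV a).1 ha) ((hV b).1 hb))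
        have h2 : a ⊔ b ∈ V := (hV _).2 (le_sup_of_le_left ((hV a).1 ha))
        simp only [hμ', ha, hb, h1, h2, if_true]
        exact hμ a b
      · have h0 : μ' b = 0 := by simp only [hμ', hb, if_false]
        rw [h0, mul_zero]
        exact mul_nonneg (hμ'nn _) (hμ'nn _)
    · have h0 : μ' a = 0 := by simp only [hμ', ha, if_false]
      rw [h0, zero_mul]
      exact mul_nonneg (hμ'nn _) (hμ'nn _)
  have key := fkg f g μ' hμ'₀ hf₀ hg₀ hfm hgm hμ'l
  -- identify the four sums
  have e1 : ∀ a, μ' a * f a = if a ∈ X ∩ V then μ a else 0 := by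
    intro a
    simp only [hμ', hf, Finset.mem_inter]
    by_cases h1 : a ∈ V <;> by_cases h2 : a ∈ X <;> simp [h1, h2]
  have e2 : ∀ a, μ' a * g a = if a ∈ Y ∩ V then μ a else 0 := by
    intro a
    simp only [hμ', hg, Finset.mem_inter]
    by_cases h1 : a ∈ V <;> by_cases h2 : a ∈ Y <;> simp [h1, h2]
  have e4 : ∀ a, μ' a * (f a * g a) = if a ∈ (X ∩ Y) ∩ V then μ a else 0 := by
    intro a
    simp only [hμ', hf, hg, Finset.mem_inter]
    by_cases h1 : a ∈ V <;> by_cases h2 : a ∈ X <;> by_cases h3 : a ∈ Y <;> simp [h1, h2, h3]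
  have s1 : ∑ a, μ' a * f a = ∑ a ∈ X ∩ V, μ a := by
    rw [Finset.sum_congr rfl (fun a _ => e1 a), Finset.sum_ite_mem, Finset.univ_inter]
  have s2 : ∑ a, μ' a * g a = ∑ a ∈ Y ∩ V, μ a := by
    rw [Finset.sum_congr rfl (fun a _ => e2 a), Finset.sum_ite_mem, Finset.univ_inter]
  have s3 : ∑ a, μ' a = ∑ a ∈ V, μ a := by
    rw [Finset.sum_ite_mem, Finset.univ_inter]
  have s4 : ∑ a, μ' a * (f a * g a) = ∑ a ∈ (X ∩ Y) ∩ V, μ a := by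
    rw [Finset.sum_congr rfl (fun a _ => e4 a), Finset.sum_ite_mem, Finset.univ_inter]
  rw [s1, s2, s3, s4] at key
  exact key

/-- **Plain Harris for two up-sets** (the case `t = ⊥`, `V = univ` of `harris_principal_filter`, for lattices with a bottom): for
a log-supermodular weight `μ ≥ 0` and up-sets `X, Y`, `μ(X)·μ(Y) ≤ μ(univ)·μ(X∩Y)`.  This is the form in which the
unconditional Harris hypotheses of `exchange_of_dom` (`v·w(X) ≤ w(X∩V)` with `Y = V`, total mass `1`) are discharged.
[FortuinKasteleynGinibre1971] -/
theorem harris_upsets [OrderBot α] (μ : α → ℝ) (hμ₀ : ∀ a, 0 ≤ μ a)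
    (hμ : ∀ a b, μ a * μ b ≤ μ (a ⊓ b) * μ (a ⊔ b)) (X Y : Finset α)
    (hX : ∀ a ∈ X, ∀ b, a ≤ b → b ∈ X) (hY : ∀ a ∈ Y, ∀ b, a ≤ b → b ∈ Y) :
    (∑ a ∈ X, μ a) * (∑ a ∈ Y, μ a) ≤ (∑ a, μ a) * (∑ a ∈ X ∩ Y, μ a) := by
  have h := harris_principal_filter μ hμ₀ hμ ⊥ univ X Y (fun a => by simp) hX hY
  simpa only [Finset.inter_univ] using h

end Summit.CriticalPhenomena.PercolationContinuityZ3.Theorems.SahiE3ExchangeDomPrincipal
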